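import Summits.QuantumFields.BalabanUV.Beta.GAN24.SymLinKernelExpansion
import Summits.QuantumFields.BalabanUV.Beta.GAN24.SlotMomentParity

/-!
# `BalabanUV.Beta.GAN24.SymLinKernelBlockMoments` — binder row G-an2-4 ∕ (CONV-C), CT-W route «WC-TL» ∕ (Q-R) «QR-LL», the (S) row of RULING
# R-gan24p1-g27-1, piece (S-β) (the OWNER gan24-p1 g27's R14 (5) ∕ R15 (x): «(S-β) = the an1-COUNT identity per letter»), PART 1b: **THE TRANSVERSE
# BLOCK REFLECTION OF ONE COARSE BOND'S SYMMETRISED LINEAR KERNEL ABOUT THE CENTRE LINE OF ITS OWN BLOCKS (centred root, `L` odd), AND THE VANISHING OF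
# ITS OFF-DIAGONAL COORDINATE MOMENTS, UNRESTRICTED AND BLOCK-RESTRICTED** (G-an2-4 formalisation swarm → CRUX TEAM (2), seat
# `b2b-balaban-gan24-formalise-leaf-02`, gen 55)

NOT IN PRINT; OUR BOOKKEEPING ([folklore] one change of variables in a `tsum` over an1's typed laws BY NAME — `SymRootedKernelReflectionCore.symLinCountAt_fref`
(the GLOBAL reflection law, centred root, `L` odd), `SymAveragingHessianCountsBounds.symLinCountAt_add` (block covariance), PART 1a `GAN24.SymLinKernelExpansion`
(transverse support), the OWNER gan24-p1's `GAN24.SlotMomentParity.tsum_eq_zero_of_anti_involutive` (an odd integrand under a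
self-bijection has zero `tsum`); 0 `def`, 0 cited fact, 0 `def … : Prop`, 0 sorry).  HONEST FRAMING (cell contract, verbatim): «discharging `BetaPertH` makes Bałaban's UV
stability UNCONDITIONAL — a real constructive-QFT result; it is NOT the continuum limit and NOT the Clay problem.»  HONEST DEPENDENCY (verbatim): «continuum YM on
T⁴ ⇐ BetaPertH ∧ nine spine estimates (0/9 proved); BetaPertH ⇐ (D1) ∧ (D4) ∧ CAP+tail; G-an2-4 gates asym, D1 and NE2/3/4.»

WHAT (coarse bond `b = (μ, y)`, centred root `r = L•y + ctr`, first-order kernel `q¹ = symLinKerAt (ctr (d+1) L) L μ y`, coordinate weight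
`W_λ(α,x) = x_λ + (x+e_α)_λ − r_λ − (r + L•e_μ)_λ` — the shape the `dψ`-laws of `GAN24.SymHessianGaugeLegContact` produce with `ψ` a coordinate function).
* §4 `bref_sub_blockShift`, **`symLinCountAt_blockRefl`** ∕ `symLinKerAt_blockRefl` — `α ≠ μ`: `q(κ, x⋆) = ε_κ · q(κ, x)` for the reflection
  `x⋆ = sref α x + (L(2y_α+1) − [κ=α])•e_α` of axis `α` through the centre line of the bond's blocks (`ε_κ = zsgn α κ`; for `κ = α` the bond is re-based at
  its other endpoint); `sref_add_smul_involutive`; the change of variables is the OWNER's `SlotMomentParity.tsum_eq_zero_of_anti_involutive` BY NAME.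
* §5 (a) **`tsum_mul_coordWeight_mul_symLinKerAt_eq_zero`** — `β ≠ β′`, any multiplier `F` blind to the in-range reflection of one transverse axis:
  `Σ'_x F(x)·W_{β′}(β,x)·q¹(β,x) = 0`; instances **`tsum_coordWeight_mul_symLinKerAt_eq_zero`** (`F = 1`) and **`tsum_blk_coordWeight_mul_symLinKerAt_eq_zero`**
  (`F = 𝟙[blk L · = t]`, every block label `t`).  Mechanism: for `β′ ≠ μ` reflect `α = β′` (the weight is odd about the EXACT centre `(L−1)/2` — this is where
  `L` odd and the centred root enter; the kernel is even, `ε_β = 1`); for `β′ = μ` reflect `α = β` (weight untouched, kernel odd, `ε_β = −1`).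
Numerics (exact rationals on the definitions, D = 2∕3, L = 3∕5, seat folder `g55/num/sbeta_check.py`): (a), the diagonal moment, the `dψ`-law and the
per-letter charge all check to 0; the diagonal BLOCK moment `Σ_{x∈B} W_β(β,x)q¹(β,x)` is NOT zero (±2, ±2∕3 at L = 3) — it cancels in the consumer only at
the Λ-lock.  Discharges NOTHING of (S) ∕ (Q-R) ∕ (LT) ∕ (Q-L) ∕ (C) ∕ «T2Shape» ∕ «T2Drift» ∕ (hW, hWall) by itself; NEVER «G-an2-4 closed» as (CONV-C); NOT D1,
NOT `BetaPertH`, NOT continuum, NOT Clay.  2026-08-22; no existing file touched.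
-/

noncomputable section

open Finset
open scoped BigOperators Nat
open Literature.MathematicalPhysics.QuantumFieldTheory.Balaban1983to89.Beta
open AffineAveraging (Form1 Site unitVec unitVec_apply box toSite)
open AveragingContours (segUp rev axial grad blk)
open AveragingContoursRooted (ctr ctrOff ctr_apply ctrOff_mem_box two_mul_half_add_one)
open TransportedContourVariables (mapForm)
open AveragingHessianKernels (Bond δ1 δ1_apply LettersIn Hull Near lettersIn_axial mem_segUp sum_eq_zero_of_lettersIn)
open ResolventReflection (sref sref_apply bref bref_apply)
open RootedKernelReflection (fref zsgn zsgn_self zsgn_of_ne zsgn_mul_self cast_zsgn)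
open Summit.QuantumFields.BalabanUV.Beta.SymmetrisedAxialPotential (symLinAvgAt symLinAvgAt_grad)
open Summit.QuantumFields.BalabanUV.Beta.SymAveragingHessianCounts
open Summit.QuantumFields.BalabanUV.Beta.SymRootedKernelReflection (symLinCountAt_fref)
open Summit.QuantumFields.BalabanUV.Beta.LinearGaugeVH (nearBox mem_nearBox summable_of_finsupp)

open Summit.QuantumFields.BalabanUV.Beta.GAN24.SymLinKernelExpansion
open Summit.QuantumFields.BalabanUV.Beta.GAN24.SlotMomentParity (tsum_eq_zero_of_anti_involutive)

namespace Summit.QuantumFields.BalabanUV.Beta.GAN24.SymLinKernelBlockMoments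

variable {d : ℕ}

/-! ## §4 The transverse block reflection of ONE coarse bond's kernel (centred root, `L` odd) -/

section Reflection

/-- [folklore] The reflected base point: an1's GLOBAL bond reflection `bref α κ` of axis `α` applied to the block-translated point is the reflection
of axis `α` through the centre line of the blocks of the coarse label `y`: `bref α κ (x − L•(y − bref α μ y)) = sref α x + (L(2y_α+1) − [κ=α])•e_α`
(`μ ≠ α`, so `bref α μ y = sref α y`). -/
theorem bref_sub_blockShift {α μ : Fin (d + 1)} (hα : α ≠ μ) (L : ℕ) (y : Fin (d + 1) → ℤ) (κ : Fin (d + 1)) (x : Fin (d + 1) → ℤ) :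
    bref α κ (x - (L : ℤ) • (y - bref α μ y))
      = sref α x + ((L : ℤ) * (2 * y α + 1) - (if κ = α then 1 else 0)) • unitVec α := by
  funext i
  simp only [bref_apply, sref_apply, Pi.sub_apply, Pi.add_apply, Pi.smul_apply, smul_eq_mul, unitVec_apply, if_neg (Ne.symm hα)]
  by_cases hi : i = α
  · subst hi
    simp only [if_true, sub_zero]
    split_ifs <;> ring
  · simp only [if_neg hi, mul_zero, add_zero, sub_zero]
    ring

/-- NOT IN PRINT; OUR BOOKKEEPING.  **THE TRANSVERSE BLOCK REFLECTION OF ONE BOND'S SYMMETRISED LINEAR COUNT** (centred root `ρ_c = ctr (d+1) L`, `L` odd,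
`α ≠ μ`): `LIN_sym,(μ,y)(κ, x⋆) = ε_κ · LIN_sym,(μ,y)(κ, x)` with `x⋆ := sref α x + (L(2y_α+1) − [κ=α])•e_α` — the reflection of axis `α` through
the centre line `x_α = L·y_α + (L−1)/2` of the bond's own blocks (for `κ = α` the bond is re-based at its other endpoint), `ε_κ = zsgn α κ`.
an1's GLOBAL law `SymRootedKernelReflectionCore.symLinCountAt_fref` (which reflects the coarse label too) composed with the block covariance
`symLinCountAt_add` that translates the reflected label `sref α y` back to `y`. -/
theorem symLinCountAt_blockRefl {L : ℕ} (hL : Odd L) {α μ : Fin (d + 1)} (hα : α ≠ μ) (y : Fin (d + 1) → ℤ) (κ : Fin (d + 1))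
    (x : Fin (d + 1) → ℤ) :
    symLinCountAt (ctr (d + 1) L) L μ y (κ, sref α x + ((L : ℤ) * (2 * y α + 1) - (if κ = α then 1 else 0)) • unitVec α)
      = zsgn α κ * symLinCountAt (ctr (d + 1) L) L μ y (κ, x) := by
  set v : Fin (d + 1) → ℤ := (L : ℤ) • (y - bref α μ y) with hv
  have h1 := symLinCountAt_fref hL α μ y (κ, x - v)
  have h2 := symLinCountAt_add (ctr (d + 1) L) L μ (bref α μ y) (y - bref α μ y) (κ, x - v)
  have e1 : bref α μ y + (y - bref α μ y) = y := by abel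
  have e2 : AveragingHessianKernels.Bond.sh ((κ, x - v) : Bond (d + 1)) ((L : ℤ) • (y - bref α μ y)) = (κ, x) := by
    show (κ, x - v + (L : ℤ) • (y - bref α μ y)) = (κ, x)
    rw [hv, sub_add_cancel]
  rw [e1, e2] at h2
  have e3 : fref α ((κ, x - v) : Bond (d + 1)) = (κ, sref α x + ((L : ℤ) * (2 * y α + 1) - (if κ = α then 1 else 0)) • unitVec α) := by
    show (κ, bref α κ (x - v)) = _
    rw [hv, bref_sub_blockShift hα]
  rw [e3, zsgn_of_ne (Ne.symm hα), mul_one, ← h2] at h1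
  simpa only using h1

/-- [folklore] The same for the real kernel `q¹_sym`. -/
theorem symLinKerAt_blockRefl {L : ℕ} (hL : Odd L) {α μ : Fin (d + 1)} (hα : α ≠ μ) (y : Fin (d + 1) → ℤ) (κ : Fin (d + 1))
    (x : Fin (d + 1) → ℤ) :
    symLinKerAt (ctr (d + 1) L) L μ y (κ, sref α x + ((L : ℤ) * (2 * y α + 1) - (if κ = α then 1 else 0)) • unitVec α)
      = (zsgn α κ : ℝ) * symLinKerAt (ctr (d + 1) L) L μ y (κ, x) := by
  rw [symLinKerAt, symLinKerAt, symLinCountAt_blockRefl hL hα, Int.cast_mul, mul_div_assoc]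

/-- [folklore] The in-block axis reflection `x ↦ sref α x + c•e_α` is an involution (any `c`). -/
theorem sref_add_smul_involutive (α : Fin (d + 1)) (c : ℤ) :
    Function.Involutive (fun x : Fin (d + 1) → ℤ => sref α x + c • unitVec α) := by
  intro x
  funext i
  simp only [Pi.add_apply, Pi.smul_apply, smul_eq_mul, sref_apply, unitVec_apply]
  split_ifs <;> ring

end Reflection

/-! ## §5 (a): the off-diagonal coordinate moments of `q¹_sym` vanish, unrestricted and block-restricted -/

section Moments

/-- [folklore] `L·c ≤ z ≤ L·c + L − 1 ⟹ z / L = c` (`1 ≤ L`). -/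
theorem ediv_eq_of_mem_range {L : ℕ} (hL : 1 ≤ L) {c z : ℤ} (h : (L : ℤ) * c ≤ z ∧ z ≤ (L : ℤ) * c + (L - 1)) : z / (L : ℤ) = c := by
  have hL0 : (0 : ℤ) < L := by exact_mod_cast hL
  obtain ⟨h1, h2⟩ := h
  have e : z = (z - (L : ℤ) * c) + (L : ℤ) * c := by ring
  rw [e, Int.add_mul_ediv_left _ _ (ne_of_gt hL0), Int.ediv_eq_zero_of_lt (by omega) (by omega), zero_add]

/-- NOT IN PRINT; OUR BOOKKEEPING ((a) of the file header).  **THE OFF-DIAGONAL COORDINATE MOMENTS OF `q¹_sym` VANISH AGAINST ANY TRANSVERSALLY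
REFLECTION-BLIND MULTIPLIER** (centred root, `L` odd): for `β ≠ β′` and any `F : Site → ℝ` that takes the same value at two points which agree off one
transverse axis `α ≠ μ` and both have their `α`-coordinate in the block range `[L·y_α, L·y_α + L − 1]` (e.g. `F = 1`, `F = 𝟙[blk L · = t]`),
`Σ'_x F(x) · (x_{β′} + (x+e_β)_{β′} − r_{β′} − (r + L•e_μ)_{β′}) · q¹_sym,(μ,y)(β, x) = 0`, `r = L•y + ρ_c`.
Proof: the integrand is ODD under the block reflection of §4 — for `β′ ≠ μ` reflect `α = β′` (weight odd: `(L−1)/2` is the exact centre; kernel even,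
`ε_β = 1`); for `β′ = μ` reflect `α = β` (weight untouched, kernel odd, `ε_β = −1`); points where the kernel vanishes pair among themselves (§3), and
where it does not, both the point and its mirror lie in the block range, so `F` agrees. -/
theorem tsum_mul_coordWeight_mul_symLinKerAt_eq_zero {L : ℕ} (hL : Odd L) (μ : Fin (d + 1)) (y : Fin (d + 1) → ℤ) {β β' : Fin (d + 1)}
    (hne : β ≠ β') {F : (Fin (d + 1) → ℤ) → ℝ}
    (hF : ∀ α, α ≠ μ → ∀ x x' : Fin (d + 1) → ℤ, (∀ i, i ≠ α → x' i = x i) →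
      ((L : ℤ) * y α ≤ x α ∧ x α ≤ (L : ℤ) * y α + (L - 1)) → ((L : ℤ) * y α ≤ x' α ∧ x' α ≤ (L : ℤ) * y α + (L - 1)) → F x' = F x) :
    ∑' x, F x * (((x β' : ℤ) : ℝ) + (((x + unitVec β) β' : ℤ) : ℝ) - ((((L : ℤ) • y + ctr (d + 1) L) β' : ℤ) : ℝ)
        - ((((L : ℤ) • y + ctr (d + 1) L + (L : ℤ) • unitVec μ) β' : ℤ) : ℝ)) * symLinKerAt (ctr (d + 1) L) L μ y (β, x) = 0 := by
  have hL1 : 1 ≤ L := by obtain ⟨m, rfl⟩ := hL; omega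
  have hctr : ∀ i, 2 * ctr (d + 1) L i = (L : ℤ) - 1 := by
    intro i
    have h := two_mul_half_add_one hL
    rw [ctr_apply]; omega
  have hr : ctrOff (d + 1) L ∈ box (d + 1) L := ctrOff_mem_box hL1
  -- the reflected axis `α`, the direction-dependent offset and the sign
  by_cases hμ : β' = μ
  · -- reflect the axis `β` (the kernel's own direction; `β ≠ μ`): the bond is re-based, the weight is untouched, the kernel flips sign
    have hβμ : β ≠ μ := fun h => hne (h.trans hμ.symm)
    let e := (sref_add_smul_involutive (d := d) β ((L : ℤ) * (2 * y β + 1) - 1)).toPerm _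
    refine tsum_eq_zero_of_anti_involutive e fun x => ?_
    have he : (e x : Fin (d + 1) → ℤ) = sref β x + ((L : ℤ) * (2 * y β + 1) - 1) • unitVec β := rfl
    have hq : symLinKerAt (ctr (d + 1) L) L μ y (β, e x) = -symLinKerAt (ctr (d + 1) L) L μ y (β, x) := by
      have h := symLinKerAt_blockRefl hL hβμ y β x
      rw [if_pos rfl, zsgn_self, Int.cast_neg, Int.cast_one, neg_one_mul] at h
      rw [he]; exact h
    have hoff : ∀ i, i ≠ β → (e x : Fin (d + 1) → ℤ) i = x i := fun i hi => by
      rw [he]; simp [sref_apply, hi]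
    have hW : (((e x : Fin (d + 1) → ℤ) β' : ℤ) : ℝ) + ((((e x : Fin (d + 1) → ℤ) + unitVec β) β' : ℤ) : ℝ)
        = ((x β' : ℤ) : ℝ) + (((x + unitVec β) β' : ℤ) : ℝ) := by
      have h1 : (e x : Fin (d + 1) → ℤ) β' = x β' := hoff β' (Ne.symm hne)
      have h2 : ((e x : Fin (d + 1) → ℤ) + unitVec β) β' = (x + unitVec β) β' := by
        simp only [Pi.add_apply, h1]
      rw [h1, h2]
    by_cases hx : symLinKerAt (ctr (d + 1) L) L μ y (β, x) = 0
    · rw [hx, hq, hx]; simp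
    · -- both base points are in the block range, so `F` agrees
      have hxr : (L : ℤ) * y β ≤ x β ∧ x β ≤ (L : ℤ) * y β + (L - 1) := by
        by_contra h; exact hx (symLinKerAt_eq_zero_of_transverse hr hβμ h)
      have hxr' : (L : ℤ) * y β ≤ (e x : Fin (d + 1) → ℤ) β ∧ (e x : Fin (d + 1) → ℤ) β ≤ (L : ℤ) * y β + (L - 1) := by
        by_contra h
        have h0 : symLinKerAt (ctr (d + 1) L) L μ y (β, e x) = 0 := symLinKerAt_eq_zero_of_transverse hr hβμ (κ := β) h
        rw [hq, neg_eq_zero] at h0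
        exact hx h0
      rw [hF β hβμ x (e x) hoff hxr hxr', hW, hq]
      ring
  · -- reflect the axis `β′` (transverse, `β′ ≠ β`): the weight is odd about the exact centre, the kernel is even
    let e := (sref_add_smul_involutive (d := d) β' ((L : ℤ) * (2 * y β' + 1) - 0)).toPerm _
    refine tsum_eq_zero_of_anti_involutive e fun x => ?_
    have he : (e x : Fin (d + 1) → ℤ) = sref β' x + ((L : ℤ) * (2 * y β' + 1) - 0) • unitVec β' := rfl
    have hq : symLinKerAt (ctr (d + 1) L) L μ y (β, e x) = symLinKerAt (ctr (d + 1) L) L μ y (β, x) := by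
      have h := symLinKerAt_blockRefl hL hμ y β x
      rw [if_neg hne, zsgn_of_ne hne, Int.cast_one, one_mul] at h
      rw [he]; exact h
    have hoff : ∀ i, i ≠ β' → (e x : Fin (d + 1) → ℤ) i = x i := fun i hi => by
      rw [he]; simp [sref_apply, hi]
    have hW : (((e x : Fin (d + 1) → ℤ) β' : ℤ) : ℝ) + ((((e x : Fin (d + 1) → ℤ) + unitVec β) β' : ℤ) : ℝ)
          - ((((L : ℤ) • y + ctr (d + 1) L) β' : ℤ) : ℝ) - ((((L : ℤ) • y + ctr (d + 1) L + (L : ℤ) • unitVec μ) β' : ℤ) : ℝ)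
        = -((((x β' : ℤ) : ℝ) + (((x + unitVec β) β' : ℤ) : ℝ)
          - ((((L : ℤ) • y + ctr (d + 1) L) β' : ℤ) : ℝ) - ((((L : ℤ) • y + ctr (d + 1) L + (L : ℤ) • unitVec μ) β' : ℤ) : ℝ))) := by
      have hc := hctr β'
      have h1 : (e x : Fin (d + 1) → ℤ) β' = -1 - x β' + (L : ℤ) * (2 * y β' + 1) := by
        rw [he]; simp [sref_apply]
      have h2 : ((e x : Fin (d + 1) → ℤ) + unitVec β) β' = -1 - x β' + (L : ℤ) * (2 * y β' + 1) := by
        rw [Pi.add_apply, h1, unitVec_apply, if_neg (Ne.symm hne), add_zero]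
      have h3 : (x + unitVec β) β' = x β' := by rw [Pi.add_apply, unitVec_apply, if_neg (Ne.symm hne), add_zero]
      have h4 : ((L : ℤ) • y + ctr (d + 1) L + (L : ℤ) • unitVec μ) β' = ((L : ℤ) • y + ctr (d + 1) L) β' := by
        rw [Pi.add_apply, Pi.smul_apply, unitVec_apply, if_neg hμ, smul_zero, add_zero]
      have h5 : ((L : ℤ) • y + ctr (d + 1) L) β' = (L : ℤ) * y β' + ctr (d + 1) L β' := by
        simp only [Pi.add_apply, Pi.smul_apply, smul_eq_mul]
      rw [h1, h2, h3, h4, h5]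
      push_cast
      have hc' : (2 : ℝ) * ((ctr (d + 1) L β' : ℤ) : ℝ) = (L : ℝ) - 1 := by exact_mod_cast hc
      linarith
    by_cases hx : symLinKerAt (ctr (d + 1) L) L μ y (β, x) = 0
    · rw [hx, hq, hx]; simp
    · have hxr : (L : ℤ) * y β' ≤ x β' ∧ x β' ≤ (L : ℤ) * y β' + (L - 1) := by
        by_contra h; exact hx (symLinKerAt_eq_zero_of_transverse hr hμ h)
      have hxr' : (L : ℤ) * y β' ≤ (e x : Fin (d + 1) → ℤ) β' ∧ (e x : Fin (d + 1) → ℤ) β' ≤ (L : ℤ) * y β' + (L - 1) := by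
        by_contra h
        have h0 : symLinKerAt (ctr (d + 1) L) L μ y (β, e x) = 0 := symLinKerAt_eq_zero_of_transverse hr hμ (κ := β) h
        rw [hq] at h0
        exact hx h0
      rw [hF β' hμ x (e x) hoff hxr hxr', hW, hq]
      ring

/-- NOT IN PRINT; OUR BOOKKEEPING.  **(a), UNRESTRICTED**: for `β ≠ β′`, `Σ'_x (x_{β′} + (x+e_β)_{β′} − r_{β′} − (r + L•e_μ)_{β′}) · q¹_sym,(μ,y)(β, x) = 0`. -/
theorem tsum_coordWeight_mul_symLinKerAt_eq_zero {L : ℕ} (hL : Odd L) (μ : Fin (d + 1)) (y : Fin (d + 1) → ℤ) {β β' : Fin (d + 1)}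
    (hne : β ≠ β') :
    ∑' x, (((x β' : ℤ) : ℝ) + (((x + unitVec β) β' : ℤ) : ℝ) - ((((L : ℤ) • y + ctr (d + 1) L) β' : ℤ) : ℝ)
        - ((((L : ℤ) • y + ctr (d + 1) L + (L : ℤ) • unitVec μ) β' : ℤ) : ℝ)) * symLinKerAt (ctr (d + 1) L) L μ y (β, x) = 0 := by
  have h := tsum_mul_coordWeight_mul_symLinKerAt_eq_zero hL μ y hne (F := fun _ => (1 : ℝ)) (fun _ _ _ _ _ _ _ => rfl)
  simpa only [one_mul] using h

/-- NOT IN PRINT; OUR BOOKKEEPING.  **(a), BLOCK-RESTRICTED**: for `β ≠ β′` and EVERY block label `t`,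
`Σ'_x 𝟙[blk L x = t] · (x_{β′} + (x+e_β)_{β′} − r_{β′} − (r + L•e_μ)_{β′}) · q¹_sym,(μ,y)(β, x) = 0`. -/
theorem tsum_blk_coordWeight_mul_symLinKerAt_eq_zero {L : ℕ} (hL : Odd L) (μ : Fin (d + 1)) (y t : Fin (d + 1) → ℤ) {β β' : Fin (d + 1)}
    (hne : β ≠ β') :
    ∑' x, (if blk L x = t then (1 : ℝ) else 0) * (((x β' : ℤ) : ℝ) + (((x + unitVec β) β' : ℤ) : ℝ)
        - ((((L : ℤ) • y + ctr (d + 1) L) β' : ℤ) : ℝ) - ((((L : ℤ) • y + ctr (d + 1) L + (L : ℤ) • unitVec μ) β' : ℤ) : ℝ))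
          * symLinKerAt (ctr (d + 1) L) L μ y (β, x) = 0 := by
  have hL1 : 1 ≤ L := by obtain ⟨m, rfl⟩ := hL; omega
  refine tsum_mul_coordWeight_mul_symLinKerAt_eq_zero hL μ y hne (F := fun x => if blk L x = t then (1 : ℝ) else 0) ?_
  intro α _ x x' hoff hx hx'
  have hb : blk L x' = blk L x := by
    funext i
    by_cases hi : i = α
    · subst hi
      show x' i / (L : ℤ) = x i / (L : ℤ)
      rw [ediv_eq_of_mem_range hL1 hx, ediv_eq_of_mem_range hL1 hx']
    · show x' i / (L : ℤ) = x i / (L : ℤ)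
      rw [hoff i hi]
  simp only [hb]

end Moments

end Summit.QuantumFields.BalabanUV.Beta.GAN24.SymLinKernelBlockMoments

end
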